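import Literature.NumberTheory.LFunctions.Zhang2022.DetectorMainTermForm

/-!
# Zhang (2022), programme F-S3 (cell landau-siegel §E, slice S-E-p6-2): the Schur-complement step of the
# `Det.FormDetPSD` certificate format

Y. Zhang, *Discrete mean estimates and the Landau–Siegel zero*, arXiv:2211.02515v1 [Zhang2022LandauSiegel] —
an unrefereed manuscript under adjudication. **WHAT THIS IS NOT: not a claim about Theorems 1–2 of
arXiv:2211.02515, about Landau–Siegel zeros, or about Parity. The programme SEARCHES and TYPES; no claim about
Landau–Siegel zeros, Theorems 1–2 of arXiv:2211.02515 or a repaired Margin232 until a kernel theorem says so.**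

Companion (algebra only) of `DetectorRecipeCertificate`: the pointwise hypothesis of
`Det.formDetPSD_of_certificate` is `0 ≤ Det.certForm R …`, a `3 × 3` Hermitian form in `(T, g, g′)` whose
`|g′|²`-pivot `(2/π)Re m₀` is a positive CONSTANT; `hermForm3_nonneg_of_schur` is the completion of two squares
(pivot, then the `2 × 2` Schur complement via `s₁₁ > 0`, `det ≥ 0`); the instance files display `certForm` in
exactly that shape (`certForm_eq_hermForm3`), so that an instance only has to certify two scalar polynomial
inequalities on `[0,1]`. Standard linear algebra, tagged with the display whose role it serves (the positivity of formula I,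
Prop. 7.1). [cite: Zhang2022LandauSiegel, §7 Prop. 7.1, §8 (8.11)–(8.23)]
-/

noncomputable section

open Complex Real ComplexConjugate

namespace Literature.NumberTheory.LFunctions.Zhang2022

namespace Det

/-! ### Algebra: a `3 × 3` Hermitian form with positive pivot and PSD Schur complement is non-negative -/

/-- For `r > 0`: `r|u|² + 2Re(ū·(p₁w + p₂v)) + q₁₁|w|² + 2Re(q₁₂ w̄ v) + q₂₂|v|² ≥ 0` for all `w, v, u`, provided the
Schur complement `s₁₁ = q₁₁ − |p₁|²/r`, `s₁₂ = q₁₂ − conj(p₁)p₂/r`, `s₂₂ = q₂₂ − |p₂|²/r` has `s₁₁ > 0` and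
`s₁₁s₂₂ − |s₁₂|² ≥ 0` (completion of two squares — the algebra behind every PSD statement of the recipe forms).
[cite: Zhang2022LandauSiegel, Prop 7.1 with (8.11)–(8.23), pp.44–50] -/
theorem hermForm3_nonneg_of_schur {r q11 q22 : ℝ} {p1 p2 q12 : ℂ} (hr : 0 < r)
    (hs11 : 0 < q11 - ‖p1‖ ^ 2 / r)
    (hdet : 0 ≤ (q11 - ‖p1‖ ^ 2 / r) * (q22 - ‖p2‖ ^ 2 / r) - ‖q12 - conj p1 * p2 / r‖ ^ 2)
    (w v u : ℂ) :
    0 ≤ r * ‖u‖ ^ 2 + 2 * (conj u * (p1 * w + p2 * v)).re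
      + q11 * ‖w‖ ^ 2 + 2 * (q12 * (conj w * v)).re + q22 * ‖v‖ ^ 2 := by
  -- Schur data
  set s11 : ℝ := q11 - ‖p1‖ ^ 2 / r with hs11d
  set s22 : ℝ := q22 - ‖p2‖ ^ 2 / r with hs22d
  set s12 : ℂ := q12 - conj p1 * p2 / r with hs12d
  set m : ℂ := p1 * w + p2 * v with hm
  -- first square: r|u + m/r|² = r|u|² + 2Re(ū m) + |m|²/r
  have sq1 : r * ‖u + m / r‖ ^ 2 = r * ‖u‖ ^ 2 + 2 * (conj u * m).re + ‖m‖ ^ 2 / r := by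
    have hr0 : (r : ℂ) ≠ 0 := by exact_mod_cast hr.ne'
    rw [Complex.sq_norm, Complex.sq_norm, Complex.sq_norm, Complex.normSq_apply, Complex.normSq_apply,
      Complex.normSq_apply]
    simp only [Complex.add_re, Complex.add_im, Complex.div_re, Complex.div_im, Complex.mul_re,
      Complex.conj_re, Complex.conj_im, Complex.ofReal_re, Complex.ofReal_im,
      Complex.normSq_ofReal]
    field_simp
    ring
  -- |m|² expanded
  have msq : ‖m‖ ^ 2 = ‖p1‖ ^ 2 * ‖w‖ ^ 2 + 2 * ((conj p1 * p2) * (conj w * v)).re + ‖p2‖ ^ 2 * ‖v‖ ^ 2 := by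
    rw [hm, Complex.sq_norm, Complex.sq_norm, Complex.sq_norm, Complex.sq_norm, Complex.sq_norm]
    simp only [Complex.normSq_apply, Complex.add_re, Complex.add_im, Complex.mul_re, Complex.mul_im,
      Complex.conj_re, Complex.conj_im]
    ring
  -- the reduced 2×2 form
  have red : r * ‖u‖ ^ 2 + 2 * (conj u * (p1 * w + p2 * v)).re
      + q11 * ‖w‖ ^ 2 + 2 * (q12 * (conj w * v)).re + q22 * ‖v‖ ^ 2
      = r * ‖u + m / r‖ ^ 2 + (s11 * ‖w‖ ^ 2 + 2 * (s12 * (conj w * v)).re + s22 * ‖v‖ ^ 2) := by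
    rw [sq1, msq, hs11d, hs22d, hs12d, ← hm]
    have : (((q12 - conj p1 * p2 / r) * (conj w * v))).re
        = (q12 * (conj w * v)).re - ((conj p1 * p2) * (conj w * v)).re / r := by
      have hr0 : (r : ℂ) ≠ 0 := by exact_mod_cast hr.ne'
      rw [sub_mul, Complex.sub_re, div_mul_eq_mul_div, Complex.div_ofReal_re]
    rw [this]
    field_simp
    ring
  -- second square: s11·(2×2 form) = |s11 w + s12 v|² + det·|v|²
  have sq2 : s11 * (s11 * ‖w‖ ^ 2 + 2 * (s12 * (conj w * v)).re + s22 * ‖v‖ ^ 2)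
      = ‖(s11 : ℂ) * w + s12 * v‖ ^ 2 + (s11 * s22 - ‖s12‖ ^ 2) * ‖v‖ ^ 2 := by
    rw [Complex.sq_norm, Complex.sq_norm, Complex.sq_norm, Complex.sq_norm]
    simp only [Complex.normSq_apply, Complex.add_re, Complex.add_im, Complex.mul_re, Complex.mul_im,
      Complex.conj_re, Complex.conj_im, Complex.ofReal_re, Complex.ofReal_im]
    ring
  have h2 : 0 ≤ s11 * ‖w‖ ^ 2 + 2 * (s12 * (conj w * v)).re + s22 * ‖v‖ ^ 2 := by
    have hprod : 0 ≤ s11 * (s11 * ‖w‖ ^ 2 + 2 * (s12 * (conj w * v)).re + s22 * ‖v‖ ^ 2) := by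
      rw [sq2]; positivity
    exact (mul_nonneg_iff_of_pos_left hs11).mp hprod
  rw [red]
  positivity

end Det

end Literature.NumberTheory.LFunctions.Zhang2022
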